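import Summits.BirchSwinnertonDyer.BirchSwinnertonDyer.Theorems.KatoDescentTamePotSupersingularTameLowerPdescShape
import Summits.BirchSwinnertonDyer.Rank1Residual.X11b.KrausMinimalityGeneralTwo
import HarnessLib

/-!
# Route `KatoDescentTamePotSupersingular` (rung K8-t′ = KT, cell `bsd-potss`), child crux `TameLowerIntrinsicNonCM`
# (item stmt-BirchSwinnertonDyer-19618), registered stub `stub_intr_residualNonCM` (REDUCIBLE disjunct) — RECORDS part 01
# (7 classes: `21150j`, `66654b`, `121104bh`, `123210cc`, `148050ea`, `161874cn`, `198927p`): the per-class LOWER half `MissingLowerBoundAt W 3` on INTRINSIC (t′) rank-0 classes with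
# `E[3]` reducible, from four PUBLISHED facts + ONE two-engine `3`-isogeny-descent certificate line per class
# (seat `bsd-potss-kt-pdesc`, ACCEL row (4) of planner bsd-potss-plan g14; `--supports stmt-BirchSwinnertonDyer-19618 --as helper`;
# closes NOTHING class-wide)

PARTITION (D-0054, cell bsd-potss): EXCLUDED-DOMAIN non-CM additive `p` · B4 (t′) (`e ∈ {3,4,6}`; here `p = 3`, Kodaira `III` (`e = 4`)),
`r_an = 0`, INTRINSIC classes (every member `3 ∣ #Ш_an`) × {`E[3]` reducible} — rows of the registered stub
`Sig.stub_intr_residualNonCM` of the birth skeleton v4 of 19618 (planner g15): on a reducible row `ρ̄` is not onto and the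
`3`-adic tower is not onto, so the row is off every Kurihara-certificate road of the skeleton. Per class; class-wide the stub
is Kato's Conj. 12.10 lower half at an additive potentially supersingular prime (OPEN). HONEST FRAMING: BSD is not proved by
any of this; nothing here is new mathematics; THEOREMS ONLY (no definition, no named fact, no `sorry`); nothing is booked here.

Each record instantiates `KTPdesc.missingLowerBoundAt_of_isIsogenous_ainvs_of_selmerGroup_ne_bot` (Selmer currency: classes
with no rational `3`-torsion anywhere in the class) or `KTPdesc.missingLowerBoundAt_of_isIsogenous_ainvs_of_shaWitness`
(Ш-witness currency: classes meeting rational `3`-torsion, where `3 ∣ #Ẽ(𝔽_ℓ)` at every good `ℓ` for every member) of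
`…TameLowerPdescShape.lean` on the literal Cremona model `W₀` of the certificate member; the conclusion holds at EVERY
globally minimal `W ∼_ℚ W₀` (binder `hiso` = the Cremona class datum). DECIDED IN THE KERNEL: `Δ ≠ 0`, global minimality
(`X11b.isGloballyMinimal_of_krausCriterion_support`: the support of `Δ` + Silverman / Kraus per prime) and, in the Selmer
currency, `3 ∤ #W₀(ℚ)_tors` from one odd good prime `ℓ` with `3 ∤ #Ẽ(𝔽_ℓ)` (`countPoints`). DISPLAYED binders: the
PUBLISHED named facts `hCT` (Cassels–Tate), `hCassels` (Cassels), `hGZK`, `hmod`; per class `hr` (`r_an = 0`, Cremona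
`allbsd`), `hs`/`hv` (`#Ш_an(W₀) = s`, `ord_3 s ≤ 2`; value quoted per docstring) and the certificate line `hSel :
Sel^(3)(W₀/ℚ) ≠ ⊥` resp. `hwit : ∃ x ∈ Ш(W₀), x ≠ 0, 3·x = 0`, whose EVIDENCE is quoted per record: the row of kit
**j257757** (this seat; engines 2χ `isogchi.gp` sha256 42175383… and 2cft `isogcft.gp` sha256 0e36e3a0… of cell
b2b-bsdres-sha-2, UNMODIFIED; two independent methods per kernel — Kummer side over the `S`-units of `L = ℚ(T)` vs.
class-field-theory side over the ray class group of `L` —, IDENTICAL `(ŝ, s_φ, m, excess)` on all 298 kernels run, both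
Poitou–Tate identities PASS, 112 null kernels with `ord_p #Ш_an = 0` on both sides all show excess `0`; `HOME/kt-pdesc/`).
Chain (PROVED in the tree below the named facts): `dim Ш(W₀)[φ] ≥ 1` ⇒ `Ш(W₀)[3] ≠ 0` (⇒ `Sel^(3)(W₀/ℚ) ≠ ⊥`) ⇒
`3 ∣ #Ш(W₀)` ⇒ `3² ∣ #Ш(W₀)` (Cassels–Tate) ⇒ `ord_3 #Ш_an(W₀) = 2 ≤ ord_3 #Ш(W₀)`; Cassels' isogeny invariance
carries the lower half to every member.

References: [SilvermanAEC2009] Thm. X.4.14, VII.1 Rem. 1.1, VII.3.1(b); [Kraus1989] Prop. 1–2; [MilneADT2006] Thm. I.7.3;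
[Miller2011LMS] Def. 1.1; [Cremona2006] Table 1; Schaefer, J. Number Theory 56 (1996) L. 3.8; [SchaeferStoll2004];
[Kato2004Asterisque] Conj. 12.10 (p. 224).
-/

set_option autoImplicit false
set_option linter.dupNamespace false

noncomputable section

open scoped Classical

open WeierstrassCurve Literature.NumberTheory.EllipticCurves
  Literature.NumberTheory.EllipticCurves.Rank1Residual
  Literature.NumberTheory.EllipticCurves.Rank1Residual.Typed
  Summit.BirchSwinnertonDyer.Rank1Residual

namespace Summit.BirchSwinnertonDyer.BirchSwinnertonDyer.Theorems

/-- **L₀ `MissingLowerBoundAt · 3` on the intrinsic (t′) class `21150j`** (`E[3]` reducible, image `B`; `N = 21150 =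
2·3^2·5^2·47`; Kodaira type `III` at `3` (`e = 4`); members: 21150j1 `#Ш_an = 9`, `#tors = 2`, `∏c = 16`, 21150j2
`#Ш_an = 9`, `#tors = 2`, `∏c = 16`, 21150j3 `#Ш_an = 9`, `#tors = 2`, `∏c = 48`, 21150j4 `#Ш_an = 9`, `#tors = 2`,
`∏c = 48`; no rational `3`-torsion in the class). Certificate member `W₀ = 21150j1 = [1, -1, 0, -1761042,
-8455155884]` (Cremona `allbsd`: `r_an = 0`, `#Ш_an(W₀) = 9`, `ord_3 = 2`). Kernel-decided: `Δ(W₀) ≠ 0`, global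
minimality (support of `Δ` = `[(2, 1, 24), (3, 2, 3), (5, 2, 15), (47, 1, 2)]` as `(q, v_q N, v_q Δ)`;
Silverman/Kraus disjunct per prime: 2:a, 3:a, 5:a, 47:a), `3 ∤ #W₀(ℚ)_tors` from `#Ẽ(𝔽_{7}) = 4`. Binders: PUBLISHED
`hCT`, `hCassels`, `hGZK`, `hmod`; per class `hr`, `hs`/`hv`, `hSel : Sel^(3)(W₀/ℚ) ≠ ⊥` — EVIDENCE: kit j257757
(this seat; 2χ `isogchi.gp` 42175383… / 2cft `isogcft.gp` 0e36e3a0…, unmodified, AGREE, duality PASS) row `21150j1`: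
rational `3`-isogeny `φ` with kernel polynomial `x - 3604` (kernel field degree `d = 2`) onto `21150j3` (`#tors =
2`, `#Ш_an = 9`), `(s_φ, ŝ, m, excess) = (1, 1, 0, 2)`, Mordell–Weil split at rank `0` `(q_φ, q_φ̂) = (0, 0)` ⇒ `dim
Ш(W₀)[φ] = s_φ − q_φ = 1 ≥ 1` (and `dim Ш(21150j3)[φ̂] = 1`) ⇒ `Ш(W₀)[3] ≠ 0` ⇒ `Sel^(3)(W₀/ℚ) ≠ ⊥` (`W₀(ℚ)[3] =
0`); `hiso`: the Cremona class 21150j (4 curves). Per class; nothing booked. [cite: SilvermanAEC2009, Thm. X.4.14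
and VII.1 Remark 1.1] [cite: Miller2011LMS, §1 and Def. 1.1] [cite: Cremona2006, Table 1 (Cremona label 21150j1)] -/
theorem KTPdesc.lower3_sel_21150j1 (hCT : exists_casselsTate_pairing (K := ℚ))
    (hCassels : bsdRHS_eq_of_isIsogenous) (hGZK : rank_eq_analyticRank_of_analyticRank_le_one)
    (hmod : hasEntireLFunction_rat) (W₀ : WeierstrassCurve ℚ) (hW₀ : W₀ = ⟨1, -1, 0, -1761042, -8455155884⟩)
    (hr : W₀.analyticRank = 0) {s : ℚ} (hs : shaAn W₀ = (s : ℂ)) (hv : padicValRat 3 s ≤ 2)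
    (hSel : W₀.selmerGroup (3 : ℤ) ≠ ⊥) (W : WeierstrassCurve ℚ) [W.IsElliptic] [W.IsGloballyMinimal]
    (hiso : IsIsogenous W W₀) : MissingLowerBoundAt W 3 := by
  subst hW₀
  haveI : Fact (Nat.Prime 3) := ⟨by norm_num⟩
  exact KTPdesc.missingLowerBoundAt_of_isIsogenous_ainvs_of_selmerGroup_ne_bot hCT hCassels hGZK hmod
    1 (-1) 0 (-1761042) (-8455155884)
    (X11b.isGloballyMinimal_of_krausCriterion_support 1 (-1) 0 (-1761042) (-8455155884)
      [(2, 1, 24), (3, 2, 3), (5, 2, 15), (47, 1, 2)]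
      (by intro t ht; simp only [List.mem_cons, List.not_mem_nil, or_false] at ht; rcases ht with rfl | rfl | rfl | rfl <;> norm_num)
      (by decide +kernel) (by decide +kernel))
    3 7 (by norm_num) (by norm_num) (by decide +kernel) (n := 4) (by decide +kernel) (by decide)
    hr hs hv hSel W hiso

/-- **L₀ `MissingLowerBoundAt · 3` on the intrinsic (t′) class `66654b`** (`E[3]` reducible, image `B`; `N = 66654 =
2·3^2·7·23^2`; Kodaira type `III` at `3` (`e = 4`); members: 66654b1 `#Ш_an = 9`, `#tors = 1`, `∏c = 4`, 66654b2
`#Ш_an = 9`, `#tors = 1`, `∏c = 4`; no rational `3`-torsion in the class). Certificate member `W₀ = 66654b1 = [1,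
-1, 0, -5906913, -5524245027]` (Cremona `allbsd`: `r_an = 0`, `#Ш_an(W₀) = 9`, `ord_3 = 2`). Kernel-decided: `Δ(W₀)
≠ 0`, global minimality (support of `Δ` = `[(2, 1, 5), (3, 2, 3), (7, 1, 3), (23, 2, 7)]` as `(q, v_q N, v_q Δ)`;
Silverman/Kraus disjunct per prime: 2:a, 3:a, 7:a, 23:a), `3 ∤ #W₀(ℚ)_tors` from `#Ẽ(𝔽_{19}) = 22`. Binders:
PUBLISHED `hCT`, `hCassels`, `hGZK`, `hmod`; per class `hr`, `hs`/`hv`, `hSel : Sel^(3)(W₀/ℚ) ≠ ⊥` — EVIDENCE: kit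
j257757 (this seat; 2χ `isogchi.gp` 42175383… / 2cft `isogcft.gp` 0e36e3a0…, unmodified, AGREE, duality PASS) row
`66654b1`: rational `3`-isogeny `φ` with kernel polynomial `x + 1397` (kernel field degree `d = 2`) onto `66654b2`
(`#tors = 1`, `#Ш_an = 9`), `(s_φ, ŝ, m, excess) = (1, 1, 0, 2)`, Mordell–Weil split at rank `0` `(q_φ, q_φ̂) = (0,
0)` ⇒ `dim Ш(W₀)[φ] = s_φ − q_φ = 1 ≥ 1` (and `dim Ш(66654b2)[φ̂] = 1`) ⇒ `Ш(W₀)[3] ≠ 0` ⇒ `Sel^(3)(W₀/ℚ) ≠ ⊥`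
(`W₀(ℚ)[3] = 0`); `hiso`: the Cremona class 66654b (2 curves). Per class; nothing booked. [cite: SilvermanAEC2009,
Thm. X.4.14 and VII.1 Remark 1.1] [cite: Miller2011LMS, §1 and Def. 1.1] [cite: Cremona2006, Table 1 (Cremona label
66654b1)] -/
theorem KTPdesc.lower3_sel_66654b1 (hCT : exists_casselsTate_pairing (K := ℚ))
    (hCassels : bsdRHS_eq_of_isIsogenous) (hGZK : rank_eq_analyticRank_of_analyticRank_le_one)
    (hmod : hasEntireLFunction_rat) (W₀ : WeierstrassCurve ℚ) (hW₀ : W₀ = ⟨1, -1, 0, -5906913, -5524245027⟩)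
    (hr : W₀.analyticRank = 0) {s : ℚ} (hs : shaAn W₀ = (s : ℂ)) (hv : padicValRat 3 s ≤ 2)
    (hSel : W₀.selmerGroup (3 : ℤ) ≠ ⊥) (W : WeierstrassCurve ℚ) [W.IsElliptic] [W.IsGloballyMinimal]
    (hiso : IsIsogenous W W₀) : MissingLowerBoundAt W 3 := by
  subst hW₀
  haveI : Fact (Nat.Prime 3) := ⟨by norm_num⟩
  exact KTPdesc.missingLowerBoundAt_of_isIsogenous_ainvs_of_selmerGroup_ne_bot hCT hCassels hGZK hmod
    1 (-1) 0 (-5906913) (-5524245027)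
    (X11b.isGloballyMinimal_of_krausCriterion_support 1 (-1) 0 (-5906913) (-5524245027)
      [(2, 1, 5), (3, 2, 3), (7, 1, 3), (23, 2, 7)]
      (by intro t ht; simp only [List.mem_cons, List.not_mem_nil, or_false] at ht; rcases ht with rfl | rfl | rfl | rfl <;> norm_num)
      (by decide +kernel) (by decide +kernel))
    3 19 (by norm_num) (by norm_num) (by decide +kernel) (n := 22) (by decide +kernel) (by decide)
    hr hs hv hSel W hiso

/-- **L₀ `MissingLowerBoundAt · 3` on the intrinsic (t′) class `121104bh`** (`E[3]` reducible, image `B`; `N =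
121104 = 2^4·3^2·29^2`; Kodaira type `III` at `3` (`e = 4`); members: 121104bh1 `#Ш_an = 9`, `#tors = 1`, `∏c = 8`,
121104bh2 `#Ш_an = 9`, `#tors = 1`, `∏c = 8`; no rational `3`-torsion in the class). Certificate member `W₀ =
121104bh1 = [0, 0, 0, -1960371, -1056482702]` (Cremona `allbsd`: `r_an = 0`, `#Ш_an(W₀) = 9`, `ord_3 = 2`).
Kernel-decided: `Δ(W₀) ≠ 0`, global minimality (support of `Δ` = `[(2, 4, 15), (3, 2, 3), (29, 2, 7)]` as `(q, v_q
N, v_q Δ)`; Silverman/Kraus disjunct per prime: 2:b, 3:a, 29:a), `3 ∤ #W₀(ℚ)_tors` from `#Ẽ(𝔽_{7}) = 7`. Binders: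
PUBLISHED `hCT`, `hCassels`, `hGZK`, `hmod`; per class `hr`, `hs`/`hv`, `hSel : Sel^(3)(W₀/ℚ) ≠ ⊥` — EVIDENCE: kit
j257757 (this seat; 2χ `isogchi.gp` 42175383… / 2cft `isogcft.gp` 0e36e3a0…, unmodified, AGREE, duality PASS) row
`121104bh1`: rational `3`-isogeny `φ` with kernel polynomial `x + 783` (kernel field degree `d = 2`) onto
`121104bh2` (`#tors = 1`, `#Ш_an = 9`), `(s_φ, ŝ, m, excess) = (1, 1, 0, 2)`, Mordell–Weil split at rank `0` `(q_φ,
q_φ̂) = (0, 0)` ⇒ `dim Ш(W₀)[φ] = s_φ − q_φ = 1 ≥ 1` (and `dim Ш(121104bh2)[φ̂] = 1`) ⇒ `Ш(W₀)[3] ≠ 0` ⇒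
`Sel^(3)(W₀/ℚ) ≠ ⊥` (`W₀(ℚ)[3] = 0`); `hiso`: the Cremona class 121104bh (2 curves). Per class; nothing booked.
[cite: SilvermanAEC2009, Thm. X.4.14 and VII.1 Remark 1.1] [cite: Miller2011LMS, §1 and Def. 1.1] [cite:
Cremona2006, Table 1 (Cremona label 121104bh1)] -/
theorem KTPdesc.lower3_sel_121104bh1 (hCT : exists_casselsTate_pairing (K := ℚ))
    (hCassels : bsdRHS_eq_of_isIsogenous) (hGZK : rank_eq_analyticRank_of_analyticRank_le_one)
    (hmod : hasEntireLFunction_rat) (W₀ : WeierstrassCurve ℚ) (hW₀ : W₀ = ⟨0, 0, 0, -1960371, -1056482702⟩)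
    (hr : W₀.analyticRank = 0) {s : ℚ} (hs : shaAn W₀ = (s : ℂ)) (hv : padicValRat 3 s ≤ 2)
    (hSel : W₀.selmerGroup (3 : ℤ) ≠ ⊥) (W : WeierstrassCurve ℚ) [W.IsElliptic] [W.IsGloballyMinimal]
    (hiso : IsIsogenous W W₀) : MissingLowerBoundAt W 3 := by
  subst hW₀
  haveI : Fact (Nat.Prime 3) := ⟨by norm_num⟩
  exact KTPdesc.missingLowerBoundAt_of_isIsogenous_ainvs_of_selmerGroup_ne_bot hCT hCassels hGZK hmod
    0 0 0 (-1960371) (-1056482702)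
    (X11b.isGloballyMinimal_of_krausCriterion_support 0 0 0 (-1960371) (-1056482702)
      [(2, 4, 15), (3, 2, 3), (29, 2, 7)]
      (by intro t ht; simp only [List.mem_cons, List.not_mem_nil, or_false] at ht; rcases ht with rfl | rfl | rfl <;> norm_num)
      (by decide +kernel) (by decide +kernel))
    3 7 (by norm_num) (by norm_num) (by decide +kernel) (n := 7) (by decide +kernel) (by decide)
    hr hs hv hSel W hiso

/-- **L₀ `MissingLowerBoundAt · 3` on the intrinsic (t′) class `123210cc`** (`E[3]` reducible, image `B`; `N =
123210 = 2·3^2·5·37^2`; Kodaira type `III` at `3` (`e = 4`); members: 123210cc1 `#Ш_an = 9`, `#tors = 2`, `∏c = 8`,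
123210cc2 `#Ш_an = 9`, `#tors = 2`, `∏c = 8`, 123210cc3 `#Ш_an = 9`, `#tors = 2`, `∏c = 24`, 123210cc4 `#Ш_an = 9`,
`#tors = 2`, `∏c = 24`; no rational `3`-torsion in the class). Certificate member `W₀ = 123210cc1 = [1, -1, 1, 7957,
72407]` (Cremona `allbsd`: `r_an = 0`, `#Ш_an(W₀) = 9`, `ord_3 = 2`). Kernel-decided: `Δ(W₀) ≠ 0`, global minimality
(support of `Δ` = `[(2, 1, 2), (3, 2, 3), (5, 1, 3), (37, 2, 6)]` as `(q, v_q N, v_q Δ)`; Silverman/Kraus disjunct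
per prime: 2:a, 3:a, 5:a, 37:a), `3 ∤ #W₀(ℚ)_tors` from `#Ẽ(𝔽_{13}) = 10`. Binders: PUBLISHED `hCT`, `hCassels`,
`hGZK`, `hmod`; per class `hr`, `hs`/`hv`, `hSel : Sel^(3)(W₀/ℚ) ≠ ⊥` — EVIDENCE: kit j257757 (this seat; 2χ
`isogchi.gp` 42175383… / 2cft `isogcft.gp` 0e36e3a0…, unmodified, AGREE, duality PASS) row `123210cc1`: rational
`3`-isogeny `φ` with kernel polynomial `x - 28` (kernel field degree `d = 2`) onto `123210cc3` (`#tors = 2`, `#Ш_an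
= 9`), `(s_φ, ŝ, m, excess) = (1, 1, 0, 2)`, Mordell–Weil split at rank `0` `(q_φ, q_φ̂) = (0, 0)` ⇒ `dim Ш(W₀)[φ] =
s_φ − q_φ = 1 ≥ 1` (and `dim Ш(123210cc3)[φ̂] = 1`) ⇒ `Ш(W₀)[3] ≠ 0` ⇒ `Sel^(3)(W₀/ℚ) ≠ ⊥` (`W₀(ℚ)[3] = 0`); `hiso`:
the Cremona class 123210cc (4 curves). Per class; nothing booked. [cite: SilvermanAEC2009, Thm. X.4.14 and VII.1
Remark 1.1] [cite: Miller2011LMS, §1 and Def. 1.1] [cite: Cremona2006, Table 1 (Cremona label 123210cc1)] -/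
theorem KTPdesc.lower3_sel_123210cc1 (hCT : exists_casselsTate_pairing (K := ℚ))
    (hCassels : bsdRHS_eq_of_isIsogenous) (hGZK : rank_eq_analyticRank_of_analyticRank_le_one)
    (hmod : hasEntireLFunction_rat) (W₀ : WeierstrassCurve ℚ) (hW₀ : W₀ = ⟨1, -1, 1, 7957, 72407⟩)
    (hr : W₀.analyticRank = 0) {s : ℚ} (hs : shaAn W₀ = (s : ℂ)) (hv : padicValRat 3 s ≤ 2)
    (hSel : W₀.selmerGroup (3 : ℤ) ≠ ⊥) (W : WeierstrassCurve ℚ) [W.IsElliptic] [W.IsGloballyMinimal]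
    (hiso : IsIsogenous W W₀) : MissingLowerBoundAt W 3 := by
  subst hW₀
  haveI : Fact (Nat.Prime 3) := ⟨by norm_num⟩
  exact KTPdesc.missingLowerBoundAt_of_isIsogenous_ainvs_of_selmerGroup_ne_bot hCT hCassels hGZK hmod
    1 (-1) 1 7957 72407
    (X11b.isGloballyMinimal_of_krausCriterion_support 1 (-1) 1 7957 72407
      [(2, 1, 2), (3, 2, 3), (5, 1, 3), (37, 2, 6)]
      (by intro t ht; simp only [List.mem_cons, List.not_mem_nil, or_false] at ht; rcases ht with rfl | rfl | rfl | rfl <;> norm_num)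
      (by decide +kernel) (by decide +kernel))
    3 13 (by norm_num) (by norm_num) (by decide +kernel) (n := 10) (by decide +kernel) (by decide)
    hr hs hv hSel W hiso

/-- **L₀ `MissingLowerBoundAt · 3` on the intrinsic (t′) class `148050ea`** (`E[3]` reducible, image `B`; `N =
148050 = 2·3^2·5^2·7·47`; Kodaira type `III` at `3` (`e = 4`); members: 148050ea1 `#Ш_an = 9`, `#tors = 1`, `∏c =
4`, 148050ea2 `#Ш_an = 9`, `#tors = 1`, `∏c = 12`; no rational `3`-torsion in the class). Certificate member `W₀ =
148050ea1 = [1, -1, 0, 932924883, 5899247349541]` (Cremona `allbsd`: `r_an = 0`, `#Ш_an(W₀) = 9`, `ord_3 = 2`).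
Kernel-decided: `Δ(W₀) ≠ 0`, global minimality (support of `Δ` = `[(2, 1, 51), (3, 2, 3), (5, 2, 10), (7, 1, 4),
(47, 1, 1)]` as `(q, v_q N, v_q Δ)`; Silverman/Kraus disjunct per prime: 2:a, 3:a, 5:a, 7:a, 47:a), `3 ∤
#W₀(ℚ)_tors` from `#Ẽ(𝔽_{13}) = 16`. Binders: PUBLISHED `hCT`, `hCassels`, `hGZK`, `hmod`; per class `hr`,
`hs`/`hv`, `hSel : Sel^(3)(W₀/ℚ) ≠ ⊥` — EVIDENCE: kit j257757 (this seat; 2χ `isogchi.gp` 42175383… / 2cft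
`isogcft.gp` 0e36e3a0…, unmodified, AGREE, duality PASS) row `148050ea1`: rational `3`-isogeny `φ` with kernel
polynomial `x - 7594` (kernel field degree `d = 2`) onto `148050ea2` (`#tors = 1`, `#Ш_an = 9`), `(s_φ, ŝ, m,
excess) = (1, 1, 0, 2)`, Mordell–Weil split at rank `0` `(q_φ, q_φ̂) = (0, 0)` ⇒ `dim Ш(W₀)[φ] = s_φ − q_φ = 1 ≥ 1`
(and `dim Ш(148050ea2)[φ̂] = 1`) ⇒ `Ш(W₀)[3] ≠ 0` ⇒ `Sel^(3)(W₀/ℚ) ≠ ⊥` (`W₀(ℚ)[3] = 0`); `hiso`: the Cremona class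
148050ea (2 curves). Per class; nothing booked. [cite: SilvermanAEC2009, Thm. X.4.14 and VII.1 Remark 1.1] [cite:
Miller2011LMS, §1 and Def. 1.1] [cite: Cremona2006, Table 1 (Cremona label 148050ea1)] -/
theorem KTPdesc.lower3_sel_148050ea1 (hCT : exists_casselsTate_pairing (K := ℚ))
    (hCassels : bsdRHS_eq_of_isIsogenous) (hGZK : rank_eq_analyticRank_of_analyticRank_le_one)
    (hmod : hasEntireLFunction_rat) (W₀ : WeierstrassCurve ℚ) (hW₀ : W₀ = ⟨1, -1, 0, 932924883, 5899247349541⟩)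
    (hr : W₀.analyticRank = 0) {s : ℚ} (hs : shaAn W₀ = (s : ℂ)) (hv : padicValRat 3 s ≤ 2)
    (hSel : W₀.selmerGroup (3 : ℤ) ≠ ⊥) (W : WeierstrassCurve ℚ) [W.IsElliptic] [W.IsGloballyMinimal]
    (hiso : IsIsogenous W W₀) : MissingLowerBoundAt W 3 := by
  subst hW₀
  haveI : Fact (Nat.Prime 3) := ⟨by norm_num⟩
  exact KTPdesc.missingLowerBoundAt_of_isIsogenous_ainvs_of_selmerGroup_ne_bot hCT hCassels hGZK hmod
    1 (-1) 0 932924883 5899247349541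
    (X11b.isGloballyMinimal_of_krausCriterion_support 1 (-1) 0 932924883 5899247349541
      [(2, 1, 51), (3, 2, 3), (5, 2, 10), (7, 1, 4), (47, 1, 1)]
      (by intro t ht; simp only [List.mem_cons, List.not_mem_nil, or_false] at ht; rcases ht with rfl | rfl | rfl | rfl | rfl <;> norm_num)
      (by decide +kernel) (by decide +kernel))
    3 13 (by norm_num) (by norm_num) (by decide +kernel) (n := 16) (by decide +kernel) (by decide)
    hr hs hv hSel W hiso

/-- **L₀ `MissingLowerBoundAt · 3` on the intrinsic (t′) class `161874cn`** (`E[3]` reducible, image `B`; `N =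
161874 = 2·3^2·17·23^2`; Kodaira type `III` at `3` (`e = 4`); members: 161874cn1 `#Ш_an = 9`, `#tors = 1`, `∏c = 2`,
161874cn2 `#Ш_an = 9`, `#tors = 1`, `∏c = 2`; no rational `3`-torsion in the class). Certificate member `W₀ =
161874cn1 = [1, -1, 0, -242674617, -1455009628563]` (Cremona `allbsd`: `r_an = 0`, `#Ш_an(W₀) = 9`, `ord_3 = 2`).
Kernel-decided: `Δ(W₀) ≠ 0`, global minimality (support of `Δ` = `[(2, 1, 9), (3, 2, 3), (17, 1, 3), (23, 2, 10)]`
as `(q, v_q N, v_q Δ)`; Silverman/Kraus disjunct per prime: 2:a, 3:a, 17:a, 23:a), `3 ∤ #W₀(ℚ)_tors` from `#Ẽ(𝔽_{7})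
= 7`. Binders: PUBLISHED `hCT`, `hCassels`, `hGZK`, `hmod`; per class `hr`, `hs`/`hv`, `hSel : Sel^(3)(W₀/ℚ) ≠ ⊥` —
EVIDENCE: kit j257757 (this seat; 2χ `isogchi.gp` 42175383… / 2cft `isogcft.gp` 0e36e3a0…, unmodified, AGREE,
duality PASS) row `161874cn1`: rational `3`-isogeny `φ` with kernel polynomial `x + 9125` (kernel field degree `d =
2`) onto `161874cn2` (`#tors = 1`, `#Ш_an = 9`), `(s_φ, ŝ, m, excess) = (1, 1, 0, 2)`, Mordell–Weil split at rank
`0` `(q_φ, q_φ̂) = (0, 0)` ⇒ `dim Ш(W₀)[φ] = s_φ − q_φ = 1 ≥ 1` (and `dim Ш(161874cn2)[φ̂] = 1`) ⇒ `Ш(W₀)[3] ≠ 0` ⇒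
`Sel^(3)(W₀/ℚ) ≠ ⊥` (`W₀(ℚ)[3] = 0`); `hiso`: the Cremona class 161874cn (2 curves). Per class; nothing booked.
[cite: SilvermanAEC2009, Thm. X.4.14 and VII.1 Remark 1.1] [cite: Miller2011LMS, §1 and Def. 1.1] [cite:
Cremona2006, Table 1 (Cremona label 161874cn1)] -/
theorem KTPdesc.lower3_sel_161874cn1 (hCT : exists_casselsTate_pairing (K := ℚ))
    (hCassels : bsdRHS_eq_of_isIsogenous) (hGZK : rank_eq_analyticRank_of_analyticRank_le_one)
    (hmod : hasEntireLFunction_rat) (W₀ : WeierstrassCurve ℚ) (hW₀ : W₀ = ⟨1, -1, 0, -242674617, -1455009628563⟩)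
    (hr : W₀.analyticRank = 0) {s : ℚ} (hs : shaAn W₀ = (s : ℂ)) (hv : padicValRat 3 s ≤ 2)
    (hSel : W₀.selmerGroup (3 : ℤ) ≠ ⊥) (W : WeierstrassCurve ℚ) [W.IsElliptic] [W.IsGloballyMinimal]
    (hiso : IsIsogenous W W₀) : MissingLowerBoundAt W 3 := by
  subst hW₀
  haveI : Fact (Nat.Prime 3) := ⟨by norm_num⟩
  exact KTPdesc.missingLowerBoundAt_of_isIsogenous_ainvs_of_selmerGroup_ne_bot hCT hCassels hGZK hmod
    1 (-1) 0 (-242674617) (-1455009628563)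
    (X11b.isGloballyMinimal_of_krausCriterion_support 1 (-1) 0 (-242674617) (-1455009628563)
      [(2, 1, 9), (3, 2, 3), (17, 1, 3), (23, 2, 10)]
      (by intro t ht; simp only [List.mem_cons, List.not_mem_nil, or_false] at ht; rcases ht with rfl | rfl | rfl | rfl <;> norm_num)
      (by decide +kernel) (by decide +kernel))
    3 7 (by norm_num) (by norm_num) (by decide +kernel) (n := 7) (by decide +kernel) (by decide)
    hr hs hv hSel W hiso

/-- **L₀ `MissingLowerBoundAt · 3` on the intrinsic (t′) class `198927p`** (`E[3]` reducible, image `B`; `N = 198927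
= 3^2·23·31^2`; Kodaira type `III` at `3` (`e = 4`); members: 198927p1 `#Ш_an = 9`, `#tors = 1`, `∏c = 4`, 198927p2
`#Ш_an = 9`, `#tors = 1`, `∏c = 4`; no rational `3`-torsion in the class). Certificate member `W₀ = 198927p1 = [0,
0, 1, -92256, -11715311]` (Cremona `allbsd`: `r_an = 0`, `#Ш_an(W₀) = 9`, `ord_3 = 2`). Kernel-decided: `Δ(W₀) ≠ 0`,
global minimality (support of `Δ` = `[(3, 2, 3), (23, 1, 3), (31, 2, 7)]` as `(q, v_q N, v_q Δ)`; Silverman/Kraus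
disjunct per prime: 3:a, 23:a, 31:a), `3 ∤ #W₀(ℚ)_tors` from `#Ẽ(𝔽_{13}) = 10`. Binders: PUBLISHED `hCT`,
`hCassels`, `hGZK`, `hmod`; per class `hr`, `hs`/`hv`, `hSel : Sel^(3)(W₀/ℚ) ≠ ⊥` — EVIDENCE: kit j257757 (this
seat; 2χ `isogchi.gp` 42175383… / 2cft `isogcft.gp` 0e36e3a0…, unmodified, AGREE, duality PASS) row `198927p1`:
rational `3`-isogeny `φ` with kernel polynomial `x + 93` (kernel field degree `d = 2`) onto `198927p2` (`#tors = 1`,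
`#Ш_an = 9`), `(s_φ, ŝ, m, excess) = (1, 1, 0, 2)`, Mordell–Weil split at rank `0` `(q_φ, q_φ̂) = (0, 0)` ⇒ `dim
Ш(W₀)[φ] = s_φ − q_φ = 1 ≥ 1` (and `dim Ш(198927p2)[φ̂] = 1`) ⇒ `Ш(W₀)[3] ≠ 0` ⇒ `Sel^(3)(W₀/ℚ) ≠ ⊥` (`W₀(ℚ)[3] =
0`); `hiso`: the Cremona class 198927p (2 curves). Per class; nothing booked. [cite: SilvermanAEC2009, Thm. X.4.14
and VII.1 Remark 1.1] [cite: Miller2011LMS, §1 and Def. 1.1] [cite: Cremona2006, Table 1 (Cremona label 198927p1)]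
-/
theorem KTPdesc.lower3_sel_198927p1 (hCT : exists_casselsTate_pairing (K := ℚ))
    (hCassels : bsdRHS_eq_of_isIsogenous) (hGZK : rank_eq_analyticRank_of_analyticRank_le_one)
    (hmod : hasEntireLFunction_rat) (W₀ : WeierstrassCurve ℚ) (hW₀ : W₀ = ⟨0, 0, 1, -92256, -11715311⟩)
    (hr : W₀.analyticRank = 0) {s : ℚ} (hs : shaAn W₀ = (s : ℂ)) (hv : padicValRat 3 s ≤ 2)
    (hSel : W₀.selmerGroup (3 : ℤ) ≠ ⊥) (W : WeierstrassCurve ℚ) [W.IsElliptic] [W.IsGloballyMinimal]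
    (hiso : IsIsogenous W W₀) : MissingLowerBoundAt W 3 := by
  subst hW₀
  haveI : Fact (Nat.Prime 3) := ⟨by norm_num⟩
  exact KTPdesc.missingLowerBoundAt_of_isIsogenous_ainvs_of_selmerGroup_ne_bot hCT hCassels hGZK hmod
    0 0 1 (-92256) (-11715311)
    (X11b.isGloballyMinimal_of_krausCriterion_support 0 0 1 (-92256) (-11715311)
      [(3, 2, 3), (23, 1, 3), (31, 2, 7)]
      (by intro t ht; simp only [List.mem_cons, List.not_mem_nil, or_false] at ht; rcases ht with rfl | rfl | rfl <;> norm_num)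
      (by decide +kernel) (by decide +kernel))
    3 13 (by norm_num) (by norm_num) (by decide +kernel) (n := 10) (by decide +kernel) (by decide)
    hr hs hv hSel W hiso

end Summit.BirchSwinnertonDyer.BirchSwinnertonDyer.Theorems

end
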